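import Mathlib
import HarnessLib
import Summits.AnomalousDissipation.AnomalousDissipation.Theorems.KolmogorovFloorEnsembleCeiling.Negative.DodgerTools

/-!
# Stub `stub_envelopeOfFarField` — the `L²`-mass envelope is automatic from the far-field clause

Crux `PointSink.ConeDesingularisation` (stmt-AnomalousDissipation-19034), line `Sketch`.

If a continuous field `Q : ℝ³ → ℝ³` is shell-`L²`-asymptotic at rate `o(λ^{5k/3})` to a field `V`
that is locally `L²` off the origin and discretely self-similar of degree `-2/3`
(`V (λ • x) = λ^{-2/3} • V x` for `x ≠ 0`), then `∫_{B_R} ‖Q‖² ≤ C R^{5/3}` for every `R ≥ 1`.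

Proof. Iterating the DSS law and changing variables `x = λ^k • y` gives the exact shell identity
`∫_{λ^k<‖x‖<λ^{k+1}} ‖V‖² = (λ^k)^{5/3} ∫_{1<‖x‖<λ} ‖V‖²` (`coneEnvelope_setIntegral_shell_normSq`).
The normalised shell errors converge, hence are bounded by some `M`, so
`∫_{shell k} ‖Q‖² ≤ 2 (M + m) (λ^k)^{5/3}` (`‖a + b‖² ≤ 2‖a‖² + 2‖b‖²`, the tree's
`KolmogorovFloorEnsembleCeiling.Negative.norm_add_sq_le_two_mul`). An induction over the balls
`B(0, λ^n)` (`B(0, λ^{n+1}) = B(0, λ^n) ∪ {λ^n ≤ ‖x‖ < λ^{n+1}}`, the sphere being Lebesgue-null) sums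
the geometric series: `∫_{B(0,λ^n)} ‖Q‖² ≤ A + K (λ^n)^{5/3}` with `K (λ^{5/3} - 1) = 2 (M + m)`;
finally `λ^n ≤ R < λ^{n+1}` (`exists_nat_pow_near`).
-/

noncomputable section

-- `Summit.<Summit>.<Problem>`: single-conjunct summit, the duplicate namespace is mandated (CONVENTIONS §2).
set_option linter.dupNamespace false

namespace Summit.AnomalousDissipation.AnomalousDissipation.Theorems

open MeasureTheory Filter Topology Set
open scoped Pointwise
-- `‖p + q‖² ≤ 2‖p‖² + 2‖q‖²`, already landed in the tree (reused, not restated).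
open KolmogorovFloorEnsembleCeiling.Negative (norm_add_sq_le_two_mul)

/-- Points / velocity values of `ℝ³`. -/
local notation "E³" => EuclideanSpace ℝ (Fin 3)

/-- `c³ · (c^{-2/3})² = c^{5/3}` for `c > 0` (the Jacobian times the squared DSS factor). -/
theorem coneEnvelope_rpow_aux {c : ℝ} (hc : 0 < c) :
    c ^ 3 * (c ^ (-(2 / 3 : ℝ))) ^ 2 = c ^ (5 / 3 : ℝ) := by
  rw [← Real.rpow_natCast c 3, ← Real.rpow_natCast _ 2, ← Real.rpow_mul hc.le, ← Real.rpow_add hc]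
  norm_num

/-- Iterating the discrete self-similarity law: `V (λ^k • y) = (λ^k)^{-2/3} • V y` off the origin. -/
theorem coneEnvelope_dss_iter {lam : ℝ} {V : E³ → E³} (hlam : 0 < lam)
    (hV : ∀ x : E³, x ≠ 0 → V (lam • x) = lam ^ (-(2 / 3 : ℝ)) • V x) (k : ℕ) (y : E³)
    (hy : y ≠ 0) : V (lam ^ k • y) = (lam ^ k) ^ (-(2 / 3 : ℝ)) • V y := by
  induction k with
  | zero => simp
  | succ k ih =>
    have hk : lam ^ k • y ≠ 0 := smul_ne_zero (pow_ne_zero _ hlam.ne') hy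
    rw [pow_succ', mul_smul, hV _ hk, ih, smul_smul, ← Real.mul_rpow hlam.le (pow_nonneg hlam.le _)]

/-- Dilating the fundamental shell: `c • {1 < ‖x‖ < λ} = {c < ‖x‖ < c λ}` for `c > 0`. -/
theorem coneEnvelope_smul_shell {c : ℝ} (lam : ℝ) (hc : 0 < c) :
    c • {x : E³ | 1 < ‖x‖ ∧ ‖x‖ < lam} = {x : E³ | c < ‖x‖ ∧ ‖x‖ < c * lam} := by
  ext x
  rw [Set.mem_smul_set_iff_inv_smul_mem₀ hc.ne']
  simp only [Set.mem_setOf_eq, norm_smul, norm_inv, Real.norm_eq_abs, abs_of_pos hc]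
  rw [← div_eq_inv_mul, one_lt_div hc, div_lt_iff₀ hc, mul_comm]

/-- `‖V‖²` is integrable on every shell `{a < ‖x‖ < b}` with `0 < a` once it is locally integrable
off the origin (the closed shell is a compact subset of `ℝ³ ∖ {0}`). -/
theorem coneEnvelope_integrableOn_shell {V : E³ → E³}
    (hV : LocallyIntegrableOn (fun x => ‖V x‖ ^ 2) {x : E³ | x ≠ 0} volume) {a : ℝ} (b : ℝ)
    (ha : 0 < a) : IntegrableOn (fun x => ‖V x‖ ^ 2) {x : E³ | a < ‖x‖ ∧ ‖x‖ < b} volume := by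
  have hK : IsCompact {x : E³ | a ≤ ‖x‖ ∧ ‖x‖ ≤ b} := by
    have : {x : E³ | a ≤ ‖x‖ ∧ ‖x‖ ≤ b} = Metric.closedBall (0 : E³) b ∩ {x | a ≤ ‖x‖} := by
      ext x
      simp [and_comm]
    rw [this]
    exact (isCompact_closedBall _ _).inter_right (isClosed_le continuous_const continuous_norm)
  refine (hV.integrableOn_compact_subset ?_ hK).mono_set fun x hx => ⟨hx.1.le, hx.2.le⟩
  intro x hx h0
  simp only [Set.mem_setOf_eq, h0, norm_zero] at hx
  linarith [hx.1]

/-- **DSS change of variables** (shared shape with `stub_dissipationPosOfFarField`). For a field `V`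
with `V (λ • x) = λ^{-2/3} • V x` off the origin,
`∫_{λ^k<‖x‖<λ^{k+1}} ‖V‖² = (λ^k)^{5/3} ∫_{1<‖x‖<λ} ‖V‖²`. -/
theorem coneEnvelope_setIntegral_shell_normSq {lam : ℝ} {V : E³ → E³} (hlam : 0 < lam)
    (hV : ∀ x : E³, x ≠ 0 → V (lam • x) = lam ^ (-(2 / 3 : ℝ)) • V x) (k : ℕ) :
    ∫ x in {x : E³ | lam ^ k < ‖x‖ ∧ ‖x‖ < lam ^ (k + 1)}, ‖V x‖ ^ 2 =
      (lam ^ k) ^ (5 / 3 : ℝ) * ∫ x in {x : E³ | 1 < ‖x‖ ∧ ‖x‖ < lam}, ‖V x‖ ^ 2 := by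
  have hc : 0 < lam ^ k := pow_pos hlam k
  have h1 := Measure.setIntegral_comp_smul_of_pos volume (fun x => ‖V x‖ ^ 2)
    {x : E³ | 1 < ‖x‖ ∧ ‖x‖ < lam} hc
  rw [coneEnvelope_smul_shell lam hc, ← pow_succ, finrank_euclideanSpace_fin, smul_eq_mul] at h1
  have h2 : ∫ x in {x : E³ | 1 < ‖x‖ ∧ ‖x‖ < lam}, ‖V (lam ^ k • x)‖ ^ 2 =
      ∫ x in {x : E³ | 1 < ‖x‖ ∧ ‖x‖ < lam}, ((lam ^ k) ^ (-(2 / 3 : ℝ))) ^ 2 * ‖V x‖ ^ 2 := by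
    refine setIntegral_congr_fun ((measurableSet_lt measurable_const measurable_norm).inter
      (measurableSet_lt measurable_norm measurable_const)) fun x hx => ?_
    have hx0 : x ≠ 0 := by
      rintro rfl
      norm_num at hx
    rw [coneEnvelope_dss_iter hlam hV k x hx0, norm_smul, mul_pow, Real.norm_eq_abs, sq_abs]
  rw [h2, integral_const_mul] at h1
  calc ∫ x in {x : E³ | lam ^ k < ‖x‖ ∧ ‖x‖ < lam ^ (k + 1)}, ‖V x‖ ^ 2
      = (lam ^ k) ^ 3 * (((lam ^ k) ^ 3)⁻¹ *
          ∫ x in {x : E³ | lam ^ k < ‖x‖ ∧ ‖x‖ < lam ^ (k + 1)}, ‖V x‖ ^ 2) := by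
        rw [← mul_assoc, mul_inv_cancel₀ (pow_ne_zero 3 hc.ne'), one_mul]
    _ = (lam ^ k) ^ (5 / 3 : ℝ) * ∫ x in {x : E³ | 1 < ‖x‖ ∧ ‖x‖ < lam}, ‖V x‖ ^ 2 := by
        rw [← h1, ← mul_assoc, coneEnvelope_rpow_aux hc]

/-- Shell comparison: on a bounded set `S` on which `‖V‖²` is integrable,
`∫_S ‖Q‖² ≤ 2 (∫_S ‖Q - V‖² + ∫_S ‖V‖²)` for `Q` continuous and `V` a.e.-strongly measurable
(`‖Q - V‖²` is then integrable on `S`, being measurable and dominated by `2‖Q‖² + 2‖V‖²`). -/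
theorem coneEnvelope_setIntegral_normSq_le {Q V : E³ → E³} (hQ : Continuous Q)
    (hVm : AEStronglyMeasurable V volume) {S : Set E³} {r : ℝ}
    (hS : S ⊆ Metric.closedBall (0 : E³) r) (hVS : IntegrableOn (fun x => ‖V x‖ ^ 2) S volume) :
    ∫ x in S, ‖Q x‖ ^ 2 ≤ 2 * ((∫ x in S, ‖Q x - V x‖ ^ 2) + ∫ x in S, ‖V x‖ ^ 2) := by
  have hQS : IntegrableOn (fun x => ‖Q x‖ ^ 2) S volume :=
    ((hQ.norm.pow 2).continuousOn.integrableOn_compact (isCompact_closedBall (0 : E³) r)).mono_set hS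
  have hg : IntegrableOn (fun x => 2 * ‖Q x‖ ^ 2 + 2 * ‖V x‖ ^ 2) S volume :=
    (hQS.const_mul 2).add (hVS.const_mul 2)
  have hQV : IntegrableOn (fun x => ‖Q x - V x‖ ^ 2) S volume := by
    refine Integrable.mono' hg ?_ (ae_of_all _ fun x => ?_)
    · exact ((hQ.aestronglyMeasurable.sub hVm).norm.pow 2).restrict
    · rw [Real.norm_of_nonneg (by positivity)]
      simpa [norm_neg, ← sub_eq_add_neg] using norm_add_sq_le_two_mul (Q x) (-V x)
  have hg' : IntegrableOn (fun x => 2 * ‖Q x - V x‖ ^ 2 + 2 * ‖V x‖ ^ 2) S volume :=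
    (hQV.const_mul 2).add (hVS.const_mul 2)
  calc ∫ x in S, ‖Q x‖ ^ 2 ≤ ∫ x in S, (2 * ‖Q x - V x‖ ^ 2 + 2 * ‖V x‖ ^ 2) := by
        refine setIntegral_mono hQS hg' fun x => ?_
        simpa using norm_add_sq_le_two_mul (Q x - V x) (V x)
    _ = 2 * ((∫ x in S, ‖Q x - V x‖ ^ 2) + ∫ x in S, ‖V x‖ ^ 2) := by
        rw [integral_add (hQV.const_mul 2) (hVS.const_mul 2), integral_const_mul, integral_const_mul,
          mul_add]

/-- One radial step: `∫_{B(0,b)} f ≤ ∫_{B(0,a)} f + ∫_{a<‖x‖<b} f` for `0 ≤ f` continuous and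
`a ≤ b` (`B(0,b) = B(0,a) ∪ {a ≤ ‖x‖ < b}` and the sphere `‖x‖ = a` is Lebesgue-null). -/
theorem coneEnvelope_ball_step {f : E³ → ℝ} (hf : Continuous f) (hf0 : ∀ x, 0 ≤ f x) {a b : ℝ}
    (hab : a ≤ b) :
    ∫ x in Metric.ball (0 : E³) b, f x ≤
      (∫ x in Metric.ball (0 : E³) a, f x) + ∫ x in {x : E³ | a < ‖x‖ ∧ ‖x‖ < b}, f x := by
  have hfi : ∀ s, s ⊆ Metric.closedBall (0 : E³) b → IntegrableOn f s volume := fun s hs =>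
    (hf.continuousOn.integrableOn_compact (isCompact_closedBall (0 : E³) b)).mono_set hs
  have hsplit : Metric.ball (0 : E³) b = Metric.ball 0 a ∪ {x : E³ | a ≤ ‖x‖ ∧ ‖x‖ < b} := by
    ext x
    simp only [Metric.mem_ball, dist_zero_right, Set.mem_union, Set.mem_setOf_eq]
    constructor
    · intro h
      by_cases h' : ‖x‖ < a
      · exact Or.inl h'
      · exact Or.inr ⟨not_lt.1 h', h⟩
    · rintro (h | ⟨-, h⟩)
      · exact lt_of_lt_of_le h hab
      · exact h
  have hdisj : Disjoint (Metric.ball (0 : E³) a) {x : E³ | a ≤ ‖x‖ ∧ ‖x‖ < b} := by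
    rw [Set.disjoint_left]
    intro x hx hx'
    simp only [Metric.mem_ball, dist_zero_right, Set.mem_setOf_eq] at hx hx'
    linarith [hx'.1]
  rw [hsplit, setIntegral_union hdisj ((measurableSet_le measurable_const measurable_norm).inter
    (measurableSet_lt measurable_norm measurable_const)) (hfi _ fun x hx => ?_) (hfi _ fun x hx => ?_)]
  · refine add_le_add le_rfl ?_
    refine setIntegral_mono_set (hfi _ fun x hx => ?_) (ae_of_all _ fun x => hf0 x) ?_
    · simp only [Set.mem_setOf_eq, Metric.mem_closedBall, dist_zero_right] at hx ⊢
      exact hx.2.le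
    · refine ae_le_set.2 (measure_mono_null (fun x hx => ?_) (Measure.addHaar_sphere volume (0 : E³) a))
      simp only [Set.mem_sdiff, Set.mem_setOf_eq, not_and, not_lt] at hx
      rw [mem_sphere_zero_iff_norm]
      obtain ⟨⟨h1, h2⟩, h3⟩ := hx
      rcases h1.lt_or_eq with h | h
      · exact absurd h2 (not_lt.2 (h3 h))
      · exact h.symm
  · simp only [Metric.mem_ball, Metric.mem_closedBall, dist_zero_right] at hx ⊢
    linarith
  · simp only [Set.mem_setOf_eq, Metric.mem_closedBall, dist_zero_right] at hx ⊢
    exact hx.2.le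

/-- **Stub 4 — `stub_envelopeOfFarField`.** THE `L²`-MASS ENVELOPE IS AUTOMATIC: if a continuous
field `Q` is shell-`L²`-asymptotic at rate `o(λ^{5k/3})` to a field `V` that is locally `L²` off the
origin and DSS of degree `-2/3` (`V (λ • x) = λ^{-2/3} • V x`), then `∫_{B_R} ‖Q‖² ≤ C R^{5/3}` for
`R ≥ 1`. Proof: `∫_{shell k} ‖V‖² = (λ^k)^{5/3} ∫_{shell 0} ‖V‖²`
(`coneEnvelope_setIntegral_shell_normSq`), the normalised shell errors are bounded (a convergent
sequence), so `∫_{shell k} ‖Q‖² ≤ 2 (M + m) (λ^k)^{5/3}`; sum the geometric series over the shells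
below `R` by induction over the balls `B(0, λ^n)` (spheres are Lebesgue-null) and add `∫_{B_1} ‖Q‖²`. -/
theorem stub_envelopeOfFarField :
    ∀ (lam : ℝ) (V Q : E³ → E³), 1 < lam → Continuous Q → AEStronglyMeasurable V volume →
      (∀ x : E³, x ≠ 0 → V (lam • x) = lam ^ (-(2 / 3 : ℝ)) • V x) →
      LocallyIntegrableOn (fun x => ‖V x‖ ^ 2) {x : E³ | x ≠ 0} volume →
      Tendsto (fun k : ℕ => (lam ^ k) ^ (-(5 / 3 : ℝ)) *
          ∫ x in {x : E³ | lam ^ k < ‖x‖ ∧ ‖x‖ < lam ^ (k + 1)}, ‖Q x - V x‖ ^ 2) atTop (𝓝 0) →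
      ∃ C : ℝ, ∀ R : ℝ, 1 ≤ R → ∫ x in Metric.ball (0 : E³) R, ‖Q x‖ ^ 2 ≤ C * R ^ (5 / 3 : ℝ) := by
  intro lam V Q hlam hQ hVm hVss hVloc hT
  have hlam0 : 0 < lam := one_pos.trans hlam
  -- (iv) the convergent sequence of normalised shell errors is bounded
  obtain ⟨M, hM⟩ := hT.bddAbove_range
  have hMk : ∀ k : ℕ, (lam ^ k) ^ (-(5 / 3 : ℝ)) *
      ∫ x in {x : E³ | lam ^ k < ‖x‖ ∧ ‖x‖ < lam ^ (k + 1)}, ‖Q x - V x‖ ^ 2 ≤ M :=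
    fun k => hM ⟨k, rfl⟩
  have hM0 : 0 ≤ M := le_trans (mul_nonneg (Real.rpow_nonneg (pow_nonneg hlam0.le 0) _)
    (integral_nonneg fun x => by positivity)) (hMk 0)
  -- (ii) the fundamental shell mass
  obtain ⟨m, hm⟩ : ∃ m : ℝ, m = ∫ x in {x : E³ | 1 < ‖x‖ ∧ ‖x‖ < lam}, ‖V x‖ ^ 2 := ⟨_, rfl⟩
  have hm0 : 0 ≤ m := hm ▸ integral_nonneg fun x => by positivity
  -- (v) the shell bound
  have hshell : ∀ k : ℕ, ∫ x in {x : E³ | lam ^ k < ‖x‖ ∧ ‖x‖ < lam ^ (k + 1)}, ‖Q x‖ ^ 2 ≤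
      2 * (M + m) * (lam ^ k) ^ (5 / 3 : ℝ) := by
    intro k
    have hck : 0 < (lam ^ k) ^ (5 / 3 : ℝ) := Real.rpow_pos_of_pos (pow_pos hlam0 k) _
    have hEk : ∫ x in {x : E³ | lam ^ k < ‖x‖ ∧ ‖x‖ < lam ^ (k + 1)}, ‖Q x - V x‖ ^ 2 ≤
        (lam ^ k) ^ (5 / 3 : ℝ) * M := by
      have h := hMk k
      rwa [Real.rpow_neg (pow_nonneg hlam0.le k), inv_mul_le_iff₀ hck] at h
    have hVk := coneEnvelope_setIntegral_shell_normSq hlam0 hVss k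
    rw [← hm] at hVk
    have h := coneEnvelope_setIntegral_normSq_le hQ hVm (S := {x : E³ | lam ^ k < ‖x‖ ∧ ‖x‖ < lam ^ (k + 1)})
      (r := lam ^ (k + 1)) (fun x hx => ?_) (coneEnvelope_integrableOn_shell hVloc _ (pow_pos hlam0 k))
    · rw [hVk] at h
      nlinarith [h, hEk]
    · simp only [Set.mem_setOf_eq, Metric.mem_closedBall, dist_zero_right] at hx ⊢
      exact hx.2.le
  -- (vi) geometric summation by induction over the balls `B(0, λ^n)`
  have hr1 : 1 < lam ^ (5 / 3 : ℝ) := Real.one_lt_rpow hlam (by norm_num)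
  obtain ⟨K, hK0, hKr⟩ : ∃ K : ℝ, 0 ≤ K ∧ K * lam ^ (5 / 3 : ℝ) = K + 2 * (M + m) := by
    have hne : lam ^ (5 / 3 : ℝ) - 1 ≠ 0 := by linarith
    refine ⟨2 * (M + m) / (lam ^ (5 / 3 : ℝ) - 1), div_nonneg (by positivity) (by linarith), ?_⟩
    linear_combination div_mul_cancel₀ (2 * (M + m)) hne
  obtain ⟨A, hA⟩ : ∃ A : ℝ, A = ∫ x in Metric.ball (0 : E³) 1, ‖Q x‖ ^ 2 := ⟨_, rfl⟩
  have hA0 : 0 ≤ A := hA ▸ integral_nonneg fun x => by positivity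
  have hQc : Continuous fun x => ‖Q x‖ ^ 2 := hQ.norm.pow 2
  have hball : ∀ n : ℕ, ∫ x in Metric.ball (0 : E³) (lam ^ n), ‖Q x‖ ^ 2 ≤
      A + K * (lam ^ n) ^ (5 / 3 : ℝ) := by
    intro n
    induction n with
    | zero => simpa [← hA] using hK0
    | succ n ih =>
      have hstep := coneEnvelope_ball_step hQc (fun x => by positivity)
        (pow_le_pow_right₀ hlam.le n.le_succ)
      rw [pow_succ lam n, Real.mul_rpow (pow_nonneg hlam0.le n) hlam0.le, ← pow_succ]
      calc ∫ x in Metric.ball (0 : E³) (lam ^ (n + 1)), ‖Q x‖ ^ 2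
          ≤ (∫ x in Metric.ball (0 : E³) (lam ^ n), ‖Q x‖ ^ 2) +
              ∫ x in {x : E³ | lam ^ n < ‖x‖ ∧ ‖x‖ < lam ^ (n + 1)}, ‖Q x‖ ^ 2 := hstep
        _ ≤ A + K * (lam ^ n) ^ (5 / 3 : ℝ) + 2 * (M + m) * (lam ^ n) ^ (5 / 3 : ℝ) :=
            add_le_add ih (hshell n)
        _ = A + K * ((lam ^ n) ^ (5 / 3 : ℝ) * lam ^ (5 / 3 : ℝ)) := by
            linear_combination -((lam ^ n) ^ (5 / 3 : ℝ)) * hKr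
  refine ⟨A + K * lam ^ (5 / 3 : ℝ), fun R hR => ?_⟩
  obtain ⟨n, hn1, hn2⟩ := exists_nat_pow_near hR hlam
  have hR53 : 1 ≤ R ^ (5 / 3 : ℝ) := Real.one_le_rpow hR (by norm_num)
  have hn53 : (lam ^ n) ^ (5 / 3 : ℝ) ≤ R ^ (5 / 3 : ℝ) :=
    Real.rpow_le_rpow (pow_nonneg hlam0.le n) hn1 (by norm_num)
  have hKr0 : 0 ≤ K * lam ^ (5 / 3 : ℝ) := by positivity
  calc ∫ x in Metric.ball (0 : E³) R, ‖Q x‖ ^ 2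
      ≤ ∫ x in Metric.ball (0 : E³) (lam ^ (n + 1)), ‖Q x‖ ^ 2 := by
        refine setIntegral_mono_set ?_ (ae_of_all _ fun x => by positivity)
          (Metric.ball_subset_ball hn2.le).eventuallyLE
        exact (hQc.continuousOn.integrableOn_compact
          (isCompact_closedBall (0 : E³) (lam ^ (n + 1)))).mono_set Metric.ball_subset_closedBall
    _ ≤ A + K * (lam ^ (n + 1)) ^ (5 / 3 : ℝ) := hball (n + 1)
    _ = A + K * lam ^ (5 / 3 : ℝ) * (lam ^ n) ^ (5 / 3 : ℝ) := by
        rw [pow_succ, Real.mul_rpow (pow_nonneg hlam0.le n) hlam0.le]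
        ring
    _ ≤ A * R ^ (5 / 3 : ℝ) + K * lam ^ (5 / 3 : ℝ) * R ^ (5 / 3 : ℝ) :=
        add_le_add (le_mul_of_one_le_right hA0 hR53) (mul_le_mul_of_nonneg_left hn53 hKr0)
    _ = (A + K * lam ^ (5 / 3 : ℝ)) * R ^ (5 / 3 : ℝ) := by ring

end Summit.AnomalousDissipation.AnomalousDissipation.Theorems

end
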